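import Literature.NumberTheory.Automorphic.IsomorphismTheoremUniqueLie
import Literature.NumberTheory.Automorphic.LieAlgebraGLNilpotentExp
import Literature.NumberTheory.Automorphic.LieCentralizerTorus
import Literature.NumberTheory.Automorphic.ChevalleyGroupAdjoint
import Literature.NumberTheory.Automorphic.RootSpaceDimension
import HarnessLib

/-!
# `T` and the root subgroups generate `G` (Springer 8.1.1 (ii)) in characteristic `0`
(trunk T-AUTOMORPHIC, G25 AutomorphicL; proof file of the named fact `torus_sup_rootSubgroups_eq`
of `IsomorphismTheoremUnique.lean`)

`IsomorphismTheoremUnique.lean` vendors Springer, *Linear Algebraic Groups*, 2nd ed., Prop. 8.1.1 (ii)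
— *"`T` and the `U_α` (`α ∈ R`) generate `G`"* for `G` connected reductive over an algebraically
closed field and `T` a maximal torus — as the named fact `torus_sup_rootSubgroups_eq` (a closed
`Prop` over `G, T ≤ GL n k`, any characteristic; `U_α = rootSubgroup G T α` is the subgroup generated
by the images of *all* root homomorphisms for `α`, item I2). This file **proves it over fields of
characteristic `0`** (`torus_sup_rootSubgroups_eq_of_charZero`), for every such `(G, T)`, by the
Lie-algebra argument of Springer 7.1.3 (i) with the leaves the tree has proved in characteristic `0`:

* `Lie(G) = 𝔤^T ⊕ ⨁_{α ∈ P} 𝔤_α` (7.1.1, `lieAlgebraGL_eq_sup_iSup_lieWeights`, any characteristic);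
* `𝔤^T ⊆ L(T)` (5.4.7 with 7.6.4 (ii); `lieWeightSpace_one_le_lieAlgebraGL_of_charZero`,
  `LieCentralizerTorus.lean`, characteristic `0`);
* **every weight space `𝔤_α`, `α ≠ 1`, lies in `Lie(U_α)`** (`lieWeightSpace_le_lieAlgebraGL_rootSubgroup`,
  characteristic `0`, for any algebraic `G` and Zariski-connected `T ≤ G`): a non-zero `A ∈ 𝔤_α` is
  nilpotent, `x ↦ exp (x A)` is a root homomorphism for `α` with values in `G`
  (`expHom_mem_rootSubgroup_of_mem_lieWeightSpace`, `LieAlgebraGLNilpotentExp.lean`), so its image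
  lies in `U_α` and its velocity `A` lies in `Lie(U_α)` (`mem_lieAlgebraGL_of_expHom_mem`). Because
  `rootSubgroup` is the supremum over *all* root homomorphisms, this needs neither `dim 𝔤_α = 1`
  (8.1.2) nor a root datum — the hypothesis `hdim` of the tree's
  `torus_sup_rootSubgroups_eq_of_lieWeights_subset`, and with it the hypothesis
  `exists_isRootDatumOf` (7.4.3) of `torus_sup_rootSubgroups_eq_of_exists_isRootDatumOf`
  (`IsomorphismTheoremUniqueCharZero.lean`), is thereby removed; in particular every non-zero
  weight is a root (`lieWeights_subset_roots`);
* the closed connected group `H = ⟨T, U_α⟩` with `Lie(H) ⊇ Lie(G)` equals `G` (2.2.7 (i), 4.4.6 with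
  1.8.2: `torus_sup_rootSubgroups_eq_of_lieAlgebraGL_le`, `IsomorphismTheoremUniqueLie.lean`).

Hence `torus_sup_rootSubgroups_eq_of_lieWeightSpace_one_le`: for *any* Zariski-connected `G` and torus
`T ≤ G` with `𝔤^T ⊆ L(T)` (characteristic `0`), `T` and the `U_α` generate `G`; and the corollary
`mem_center_iff_forall_roots_of_charZero`: Springer 8.1.8 (i) (`mem_center_iff_forall_roots`) in
characteristic `0` from 7.6.4 (ii) (`centralizer_eq_of_isMaximalTorusIn`) alone.

Not here: positive characteristic. There the exponential is unavailable and the printed proof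
(7.1.3 (i) with 5.4.7; the groups `G_α = Z_G((Ker α)°)` of semisimple rank one, 7.6.4 (i), 7.3.2–7.3.3)
rests on leaves that are undischarged named facts of the tree (`lieWeightSpace_one_le_lieAlgebraGL`,
`lieWeights_eq_roots`, `isConnectedReductive_centralizer_torus`, `exists_rootHom_sup_isBorelIn_of_central`);
the assembly `torus_sup_rootSubgroups_eq_of_lieWeights_eq_roots` (`IsomorphismTheoremUniqueLie.lean`)
records the reduction to the first two in every characteristic, restated here with both hypotheses
in their named-fact form (`torus_sup_rootSubgroups_eq_of_facts`), so that the discharge in every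
characteristic is `torus_sup_rootSubgroups_eq_of_facts lieWeights_eq_roots_holds
(lieWeightSpace_one_le_lieAlgebraGL_holds G T)` once those two facts are discharged. No new named
fact is introduced.

## References

* [SpringerLAG1998] T. A. Springer, *Linear Algebraic Groups*, 2nd ed., Progress in Mathematics 9,
  Birkhäuser (1998): Prop. 8.1.1 (ii) and its proof, Lemma 7.1.3 (i) and its proof, 7.1.1,
  Cor. 5.4.7, Cor. 7.6.4 (ii), 2.2.7 (i), 4.4.6, 4.4.15 (1), Prop. 8.1.8 (i).
-/

noncomputable section

open scoped MatrixGroups IsMulCommutative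

namespace Literature.NumberTheory.Automorphic

variable {k : Type*} [Field k] {n : Type*} [Fintype n] [DecidableEq n]
variable {G T : Subgroup (GL n k)}

/-! ### Weight spaces lie in the Lie algebras of the root subgroups (characteristic `0`) -/

/-- **`𝔤_α ⊆ Lie(U_α)` in characteristic `0`.** Let `G ≤ GL n k` be algebraic over a field of
characteristic `0`, `T ≤ G` Zariski-connected and `α ≠ 1` an algebraic character of `T`. Then the
weight space `𝔤_α = lieWeightSpace G T α` lies in the Lie algebra of the root subgroup
`U_α = rootSubgroup G T α`: a non-zero `A ∈ 𝔤_α` is nilpotent and `x ↦ exp (x A)` is a root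
homomorphism of `(G, T)` for `α` (`expHom_mem_rootSubgroup_of_mem_lieWeightSpace`), whose image lies
in `U_α` by the very definition of `rootSubgroup` (the subgroup generated by the images of all root
homomorphisms for `α`) and whose velocity is `A` (`mem_lieAlgebraGL_of_expHom_mem`; Springer
4.4.15 (1), 8.1.1 (i): `Im du_α ⊆ L(U_α)`). [cite: SpringerLAG1998, Prop. 8.1.1 (i) and 4.4.15 (1)] -/
theorem lieWeightSpace_le_lieAlgebraGL_rootSubgroup [CharZero k] (hG : IsAlgebraicSubgroup G)
    (hT : IsZConnected T) (hTG : T ≤ G) {α : ↥T →* kˣ} (hα : IsAlgebraicChar α) (hα1 : α ≠ 1) :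
    lieWeightSpace G T α ≤ lieAlgebraGL (rootSubgroup G T α) := by
  intro A hA
  by_cases hA0 : A = 0
  · rw [hA0]
    exact Submodule.zero_mem _
  have hAn : IsNilpotent A := isNilpotent_of_mem_weightSpaceGL hT hα hα1 hA.2
  have hmem : ∀ x, expHom A hAn x ∈ rootSubgroup G T α := fun x => by
    obtain ⟨_, h⟩ := expHom_mem_rootSubgroup_of_mem_lieWeightSpace hG hT hTG hα hα1 hA hA0 x
    exact h
  exact mem_lieAlgebraGL_of_expHom_mem hAn hmem

/-! ### Generation by `T` and the root subgroups (Springer 8.1.1 (ii), characteristic `0`) -/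

/-- **`T` and the `U_α` generate `G` as soon as `𝔤^T ⊆ L(T)` (characteristic `0`).** Let
`G ≤ GL n k` be Zariski-connected over an algebraically closed field of characteristic `0` and
`T ≤ G` a torus such that the fixed points `𝔤^T = lieWeightSpace G T 1` of `Ad(T)` in `Lie(G)`
lie in `Lie(T)` (Springer 5.4.7: `𝔤^T = L(Z_G(T))`; e.g. `Z_G(T)° = T`). Then
`T ⊔ ⨆_{α ∈ R} U_α = G`: by 7.1.1 `Lie(G) = 𝔤^T + ∑_{α ∈ P} 𝔤_α`, each `𝔤_α` (`α ∈ P`) lies in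
`Lie(U_α)` (`lieWeightSpace_le_lieAlgebraGL_rootSubgroup`) with `α ∈ R` (`lieWeights_subset_roots`),
so `Lie(G) ⊆ Lie(T) + ∑_{α ∈ R} Lie(U_α)` and `torus_sup_rootSubgroups_eq_of_lieAlgebraGL_le` (the
argument of Springer 7.1.3 (i): the generated group is closed, connected, with Lie algebra `Lie(G)`)
applies. [cite: SpringerLAG1998, Prop. 8.1.1 (ii) with Lemma 7.1.3 (i)] -/
theorem torus_sup_rootSubgroups_eq_of_lieWeightSpace_one_le [IsAlgClosed k] [CharZero k]
    (hG : IsZConnected G) (hT : IsTorusSubgroup T) (hTG : T ≤ G)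
    (h0 : lieWeightSpace G T 1 ≤ lieAlgebraGL T) :
    T ⊔ ⨆ α ∈ roots G T, rootSubgroup G T (α : ↥T →* kˣ) = G := by
  haveI : IsMulCommutative ↥T := hT.2.1
  refine torus_sup_rootSubgroups_eq_of_lieAlgebraGL_le hG hT hTG ?_
  rw [lieAlgebraGL_eq_sup_iSup_lieWeights T hTG hT.2.2]
  refine sup_le (h0.trans le_sup_left) (iSup₂_le fun α hαP => ?_)
  have hα : α ∈ roots G T := lieWeights_subset_roots hG.1 hT.1 hTG hαP
  exact le_sup_of_le_right (le_iSup₂_of_le α hα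
    (lieWeightSpace_le_lieAlgebraGL_rootSubgroup hG.1 hT.1 hTG α.2 hα.1))

/-- **Springer 8.1.1 (ii) in characteristic `0`: the named fact `torus_sup_rootSubgroups_eq` holds
for `(G, T)` over fields of characteristic `0`.** For `G ≤ GL n k` connected reductive over an
algebraically closed field of characteristic `0` and `T` a maximal torus, *`T` and the root subgroups
`U_α` (`α ∈ R`) generate `G`*: `𝔤^T ⊆ L(T)` holds (`lieWeightSpace_one_le_lieAlgebraGL_of_charZero`,
Springer 5.4.7 with 7.6.4 (ii), `LieCentralizerTorus.lean`) and
`torus_sup_rootSubgroups_eq_of_lieWeightSpace_one_le` applies. (Springer proves 8.1.1 (ii) in every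
characteristic; the positive-characteristic case is not covered here, see the module docstring.)
[cite: SpringerLAG1998, Prop. 8.1.1 (ii)] -/
theorem torus_sup_rootSubgroups_eq_of_charZero [CharZero k] :
    torus_sup_rootSubgroups_eq (G := G) (T := T) := by
  intro _ hG hT
  exact torus_sup_rootSubgroups_eq_of_lieWeightSpace_one_le hG.1 hT.2.1 hT.1
    (lieWeightSpace_one_le_lieAlgebraGL_of_charZero hG hT)

/-- **Springer 8.1.8 (i) in characteristic `0` from 7.6.4 (ii) alone**: granted `Z_G(T) = T`
(the named fact `centralizer_eq_of_isMaximalTorusIn`, `RootSubgroupStructure.lean`), the centre of a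
connected reductive `G ≤ GL n k` over an algebraically closed field of characteristic `0` is
`⋂_{α ∈ R} Ker α ⊆ T` (`mem_center_iff_forall_roots`), by `mem_center_iff_forall_roots_of` and
`torus_sup_rootSubgroups_eq_of_charZero`. [cite: SpringerLAG1998, Prop. 8.1.8 (i)] -/
theorem mem_center_iff_forall_roots_of_charZero [CharZero k]
    (h : centralizer_eq_of_isMaximalTorusIn (k := k) (n := n)) :
    mem_center_iff_forall_roots (G := G) (T := T) :=
  mem_center_iff_forall_roots_of h torus_sup_rootSubgroups_eq_of_charZero

/-! ### Every characteristic: the reduction to Springer 8.1.2 and 5.4.7 / 7.6.4 (ii) -/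

/-- **`torus_sup_rootSubgroups_eq` (Springer 8.1.1 (ii)) in every characteristic from the two named
facts `lieWeights_eq_roots` (8.1.2: `P = R` and `dim 𝔤_α = 1`) and
`lieWeightSpace_one_le_lieAlgebraGL` (`𝔤^T ⊆ L(T)`, 5.4.7 with 7.6.4 (ii))** — the tree's
`torus_sup_rootSubgroups_eq_of_lieWeights_eq_roots` / `torus_sup_rootSubgroups_eq_of_lieWeights_subset`
(the argument of 7.1.3 (i), valid over any algebraically closed field: `Lie(G) = 𝔤^T + ∑_{α ∈ P} 𝔤_α`,
`𝔤_α = k · du_α ⊆ Lie(U_α)` for a root homomorphism `u_α`, and `⟨T, U_α⟩` is closed connected with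
Lie algebra `Lie(G)`), with both hypotheses in the exact shape of the named facts. In characteristic
`0` both hypotheses are superfluous (`torus_sup_rootSubgroups_eq_of_charZero`).
[cite: SpringerLAG1998, Prop. 8.1.1 (ii) with Lemma 7.1.3 (i), Cor. 8.1.2, Cor. 5.4.7] -/
theorem torus_sup_rootSubgroups_eq_of_facts (h₁ : lieWeights_eq_roots (G := G) (T := T))
    (h₂ : lieWeightSpace_one_le_lieAlgebraGL G T) :
    torus_sup_rootSubgroups_eq (G := G) (T := T) := by
  intro _ hG hT
  exact torus_sup_rootSubgroups_eq_of_lieWeights_subset hG.1 hT.2.1 hT.1 (h₁ hG hT).1.le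
    (fun α hα => ((h₁ hG hT).2 α hα).le) (h₂ hG hT)

end Literature.NumberTheory.Automorphic

end
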